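import Mathlib.AlgebraicGeometry.Noetherian
import Mathlib.AlgebraicGeometry.Morphisms.FiniteType
import Literature.AlgebraicGeometry.Resolution.StalkSpecializesLocalization
import Literature.AlgebraicGeometry.Resolution.CohenMacaulayLocalization
import Literature.AlgebraicGeometry.Resolution.MacaulayficationOfCMBlowup
import HarnessLib

/-!
# A scheme of finite type over a field is Cohen–Macaulay if it is so at its closed points

Topic: `Literature/AlgebraicGeometry/Resolution`. Scheme-level consequence of
`CohenMacaulayLocalization.lean` (Matsumura, Thm. 17.3 (iii): Cohen–Macaulayness localizes) and the
step of the printed proofs of Macaulayfication that it serves: *"since Cohen–Macaulayness is stable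
under localization (see [EGA IV₁, 0.16.5.10 (i)]), it suffices to show that the depth of `Bl_I(M)`
at each closed point of its support is `≥ dim(Supp(M))`"* (Česnavičius 2021, proof of Thm. 3.13;
likewise Kawasaki 2000, proof of Thm. 4.1). In the stalkwise inline vocabulary of the named facts
`KawasakiMacaulayfication` / `CesnaviciusMacaulayfication` (every system of parameters of the stalk
is a weakly regular sequence):

* `cmClause_of_specializes` — on a locally Noetherian scheme the clause passes from a point `y`
  to every generization `x ⤳ y` (`𝒪_{X,x}` is a localization of `𝒪_{X,y}` at a prime,
  Stacks 01J7 = `isLocalizationAtPrime_stalkSpecializes`);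
* `cmClause_of_closedPoints` — on a locally Noetherian Jacobson scheme (e.g. locally of finite
  type over a field, `cmClause_of_closedPoints_of_locallyOfFiniteType`) the clause at the CLOSED
  points implies the clause at ALL points;
* `kawasakiMacaulayfication_of_exists_isBlowup_closedPoints`,
  `cesnaviciusMacaulayfication_of_exists_isBlowup_closedPoints` — hence the top glue of
  `MacaulayficationOfCMBlowup.lean` needs the Cohen–Macaulay clause of the blowing up only at its
  closed points: both named facts follow from the existence, for every integral `X` separated and
  of finite type over a field, of a blowing up along a non-zero ideal sheaf (off the Cohen–Macaulay
  points, for the second) whose stalks at CLOSED points are Cohen–Macaulay — exactly the output of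
  Kawasaki's Thm. 4.1 / Česnavičius's Thm. 3.13 with §5.

Everything is proved; no named fact is introduced.

## References

* [Matsumura1987] H. Matsumura, *Commutative Ring Theory*, Thm. 17.3 (iii).
* [Cesnavicius2021] K. Česnavičius, Duke Math. J. 170 (2021), proof of Thm. 3.13 (reduction to
  closed points), Thm. 5.3.
* [Kawasaki2000] T. Kawasaki, Trans. AMS 352 (2000), proof of Thm. 4.1.
* The Stacks Project, Tag 01J7; EGA IV₁ 0.16.5.10 (i).
-/

noncomputable section

open CategoryTheory AlgebraicGeometry TopologicalSpace IsLocalRing RingTheory.Sequence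

namespace Literature.AlgebraicGeometry.Resolution

universe u

variable {X : Scheme.{u}}

/-- **The Cohen–Macaulay clause passes to generizations** (Matsumura 17.3 (iii) on stalks): on a
locally Noetherian scheme, if every system of parameters of `𝒪_{X,y}` is weakly regular and
`x ⤳ y`, then every system of parameters of `𝒪_{X,x}` is weakly regular — `𝒪_{X,x}` is the
localization of `𝒪_{X,y}` at a prime (Stacks 01J7). [cite: Matsumura1987, Thm. 17.3 (iii)] -/
theorem cmClause_of_specializes [IsLocallyNoetherian X] {x y : X} (hxy : x ⤳ y)
    (hy : ∀ d : ℕ, ringKrullDim (X.presheaf.stalk y) = d →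
      ∀ s : Fin d → X.presheaf.stalk y, (Ideal.span (Set.range s)).radical.IsMaximal →
        IsWeaklyRegular (X.presheaf.stalk y) (List.ofFn s)) :
    ∀ d : ℕ, ringKrullDim (X.presheaf.stalk x) = d →
      ∀ s : Fin d → X.presheaf.stalk x, (Ideal.span (Set.range s)).radical.IsMaximal →
        IsWeaklyRegular (X.presheaf.stalk x) (List.ofFn s) := by
  letI := (X.presheaf.stalkSpecializes hxy).hom.toAlgebra
  haveI := isLocalizationAtPrime_stalkSpecializes hxy
  exact cmClause_of_isLocalization_atPrime hy
    ((maximalIdeal (X.presheaf.stalk x)).comap (X.presheaf.stalkSpecializes hxy).hom)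
    (X.presheaf.stalk x)

/-- In a Jacobson space every point specialises to a closed point. [folklore] -/
private theorem exists_isClosed_and_specializes {Y : Type*} [TopologicalSpace Y]
    [JacobsonSpace Y] (a : Y) : ∃ b : Y, IsClosed ({b} : Set Y) ∧ a ⤳ b := by
  obtain ⟨b, hbZ, hbcl⟩ := nonempty_inter_closedPoints (Z := closure ({a} : Set Y))
    ⟨a, subset_closure rfl⟩ isClosed_closure.isLocallyClosed
  exact ⟨b, hbcl, specializes_iff_mem_closure.mpr hbZ⟩

/-- **Cohen–Macaulay at the closed points ⇒ Cohen–Macaulay** (EGA IV₁ 0.16.5.10 (i) /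
Matsumura 17.3 (iii), scheme form): on a locally Noetherian Jacobson scheme, if every system of
parameters of the stalk at every CLOSED point is weakly regular, then the same holds at every
point (every point specializes to a closed point, and the clause passes to generizations).
[cite: Matsumura1987, Thm. 17.3 (iii)] -/
theorem cmClause_of_closedPoints [IsLocallyNoetherian X] [JacobsonSpace X]
    (h : ∀ y : X, IsClosed ({y} : Set X) → ∀ d : ℕ, ringKrullDim (X.presheaf.stalk y) = d →
      ∀ s : Fin d → X.presheaf.stalk y, (Ideal.span (Set.range s)).radical.IsMaximal →
        IsWeaklyRegular (X.presheaf.stalk y) (List.ofFn s)) :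
    ∀ x : X, ∀ d : ℕ, ringKrullDim (X.presheaf.stalk x) = d →
      ∀ s : Fin d → X.presheaf.stalk x, (Ideal.span (Set.range s)).radical.IsMaximal →
        IsWeaklyRegular (X.presheaf.stalk x) (List.ofFn s) := by
  intro x
  obtain ⟨y, hyc, hxy⟩ := exists_isClosed_and_specializes x
  exact cmClause_of_specializes hxy (h y hyc)

/-- **Cohen–Macaulay at the closed points ⇒ Cohen–Macaulay, for schemes locally of finite type
over a field** (such schemes are locally Noetherian and Jacobson). [cite: Matsumura1987, Thm. 17.3 (iii)] -/
theorem cmClause_of_closedPoints_of_locallyOfFiniteType {k : Type u} [Field k]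
    (f : X ⟶ Spec (.of k)) [LocallyOfFiniteType f]
    (h : ∀ y : X, IsClosed ({y} : Set X) → ∀ d : ℕ, ringKrullDim (X.presheaf.stalk y) = d →
      ∀ s : Fin d → X.presheaf.stalk y, (Ideal.span (Set.range s)).radical.IsMaximal →
        IsWeaklyRegular (X.presheaf.stalk y) (List.ofFn s)) :
    ∀ x : X, ∀ d : ℕ, ringKrullDim (X.presheaf.stalk x) = d →
      ∀ s : Fin d → X.presheaf.stalk x, (Ideal.span (Set.range s)).radical.IsMaximal →
        IsWeaklyRegular (X.presheaf.stalk x) (List.ofFn s) := by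
  haveI : JacobsonSpace X := LocallyOfFiniteType.jacobsonSpace f
  haveI : IsLocallyNoetherian X := LocallyOfFiniteType.isLocallyNoetherian f
  exact cmClause_of_closedPoints h

/-! ## The top glue of Macaulayfication, with Cohen–Macaulayness checked at closed points only -/

/-- **Kawasaki's Macaulayfication from a blowing up that is Cohen–Macaulay at its closed points**
(Kawasaki 2000, Thm. 4.1 + §5 ⇒ Thm. 1.1; Česnavičius 2021, Thm. 3.13 + Thm. 5.3 ⇒ Thm. 1.6): if
every integral `X` separated and of finite type over a field admits a non-zero ideal sheaf `J` and
a blowing up `π : X' → X` along `J` such that every system of parameters of `𝒪_{X',x'}` is weakly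
regular for every CLOSED point `x'`, then `KawasakiMacaulayfication` holds (`X'` is of finite type
over the field, so the clause spreads from the closed points to all points, and
`kawasakiMacaulayfication_of_exists_isBlowup` applies). [cite: Kawasaki2000, Thm. 1.1 (proof, §4–§5)] -/
theorem kawasakiMacaulayfication_of_exists_isBlowup_closedPoints
    (h : ∀ (k : Type u) [Field k] (X : Scheme.{u}) (f : X ⟶ Spec (.of k)),
      IsSeparated f → LocallyOfFiniteType f → QuasiCompact f → IsIntegral X →
        ∃ (J : X.IdealSheafData) (X' : Scheme.{u}) (π : X' ⟶ X), J ≠ ⊥ ∧ IsBlowup π J ∧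
          ∀ x : X', IsClosed ({x} : Set X') → ∀ d : ℕ, ringKrullDim (X'.presheaf.stalk x) = d →
            ∀ s : Fin d → X'.presheaf.stalk x, (Ideal.span (Set.range s)).radical.IsMaximal →
              IsWeaklyRegular (X'.presheaf.stalk x) (List.ofFn s)) :
    KawasakiMacaulayfication.{u} := by
  refine kawasakiMacaulayfication_of_exists_isBlowup fun k _ X f hs hl hq hX => ?_
  obtain ⟨J, X', π, hJ, hπ, hCM⟩ := h k X f hs hl hq hX
  haveI := hl
  haveI : IsLocallyNoetherian X := LocallyOfFiniteType.isLocallyNoetherian f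
  haveI : IsProper π := hπ.isProper
  exact ⟨J, X', π, hJ, hπ, cmClause_of_closedPoints_of_locallyOfFiniteType (π ≫ f) hCM⟩

/-- **Česnavičius's Macaulayfication from a blowing up, centred off the Cohen–Macaulay locus,
that is Cohen–Macaulay at its closed points** (Česnavičius 2021, Thm. 3.13 + Thm. 5.3 ⇒
Thm. 1.6): as `cesnaviciusMacaulayfication_of_exists_isBlowup`, with the Cohen–Macaulay clause of
the blowing up required at its closed points only. [cite: Cesnavicius2021, Thm. 5.3 and Thm. 1.6] -/
theorem cesnaviciusMacaulayfication_of_exists_isBlowup_closedPoints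
    (h : ∀ (k : Type u) [Field k] (X : Scheme.{u}) (f : X ⟶ Spec (.of k)),
      IsSeparated f → LocallyOfFiniteType f → QuasiCompact f → IsIntegral X →
        ∃ (J : X.IdealSheafData) (X' : Scheme.{u}) (π : X' ⟶ X), J ≠ ⊥ ∧ IsBlowup π J ∧
          (∀ x : X, x ∈ (J.support : Set X) →
            ¬ ∀ d : ℕ, ringKrullDim (X.presheaf.stalk x) = d →
              ∀ s : Fin d → X.presheaf.stalk x, (Ideal.span (Set.range s)).radical.IsMaximal →
                IsWeaklyRegular (X.presheaf.stalk x) (List.ofFn s)) ∧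
          ∀ x : X', IsClosed ({x} : Set X') → ∀ d : ℕ, ringKrullDim (X'.presheaf.stalk x) = d →
            ∀ s : Fin d → X'.presheaf.stalk x, (Ideal.span (Set.range s)).radical.IsMaximal →
              IsWeaklyRegular (X'.presheaf.stalk x) (List.ofFn s)) :
    CesnaviciusMacaulayfication.{u} := by
  refine cesnaviciusMacaulayfication_of_exists_isBlowup fun k _ X f hs hl hq hX => ?_
  obtain ⟨J, X', π, hJ, hπ, hZ, hCM⟩ := h k X f hs hl hq hX
  haveI := hl
  haveI : IsLocallyNoetherian X := LocallyOfFiniteType.isLocallyNoetherian f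
  haveI : IsProper π := hπ.isProper
  exact ⟨J, X', π, hJ, hπ, hZ, cmClause_of_closedPoints_of_locallyOfFiniteType (π ≫ f) hCM⟩

/-! ## The shape of Česnavičius's Thm 5.3: Cohen–Macaulay off the centre from `X`, at the closed
points over the centre from the blowing up -/

/-- The Cohen–Macaulay clause transports along a ring isomorphism (pull the tuple back along
`e.symm`, push weak regularity forward; also `cmClause_of_ringEquiv` of
`PrincipalizationFromMacaulayfication.lean`, re-proved here to keep the imports of this file
small). [folklore] -/
private theorem cmClause_transport {A B : Type u} [CommRing A] [CommRing B] (e : A ≃+* B)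
    (hcm : ∀ d : ℕ, ringKrullDim A = d → ∀ s : Fin d → A,
      (Ideal.span (Set.range s)).radical.IsMaximal → IsWeaklyRegular A (List.ofFn s)) :
    ∀ d : ℕ, ringKrullDim B = d → ∀ s : Fin d → B,
      (Ideal.span (Set.range s)).radical.IsMaximal → IsWeaklyRegular B (List.ofFn s) := by
  intro d hd s hmax
  have hdA : ringKrullDim A = d := by rw [ringKrullDim_eq_of_ringEquiv e, hd]
  have hI : Ideal.span (Set.range (e.symm ∘ s)) = (Ideal.span (Set.range s)).comap e := by
    rw [Set.range_comp, ← Ideal.map_span, Ideal.map_symm]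
  have hmaxA : (Ideal.span (Set.range (e.symm ∘ s))).radical.IsMaximal := by
    rw [hI, ← Ideal.comap_radical]
    exact Ideal.comap_isMaximal_of_equiv e
  have hreg := hcm d hdA (e.symm ∘ s) hmaxA
  have hmap : List.ofFn s = (List.ofFn (e.symm ∘ s)).map e := by
    rw [List.map_ofFn]
    congr 1
    funext i
    simp
  rw [hmap]
  refine (AddEquiv.isWeaklyRegular_congr (e := e.toAddEquiv) ?_).mp hreg
  refine List.forall₂_map_right_iff.mpr (List.forall₂_same.mpr fun r _ x => ?_)
  change e (r * x) = e r * e x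
  exact map_mul e r x

/-- If `π` restricts to an isomorphism over an open `U ⊆ X` and `π x ∈ U`, then the stalk map
`𝒪_{X, π x} ⟶ 𝒪_{X', x}` is an isomorphism (also in `BlowupsFlatBaseChange.lean`; re-proved to keep
the imports small). [folklore] -/
private theorem isIso_stalkMap_of_isIso_restrict {X' : Scheme.{u}} (π : X' ⟶ X) (U : X.Opens)
    [IsIso (π ∣_ U)] (x : X') (hx : π x ∈ U) : IsIso (π.stalkMap x) := by
  let x₀ : ↑(π ⁻¹ᵁ U) := ⟨x, hx⟩
  have h1 : IsIso ((π ∣_ U).stalkMap x₀) := inferInstance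
  have e := morphismRestrictStalkMap π U x₀
  exact (Arrow.isIso_iff_isIso_of_isIso e.hom).mp h1 |> fun h => by simpa using h

/-- **The Cohen–Macaulay verification of a blowing up, in the shape of Česnavičius's Thm 5.3**:
let `X` be locally of finite type over a field and `π : X' → X` a blowing up along `J`. If the
stalks of `X` at the points OFF the support of `J` are Cohen–Macaulay (in Thm 5.3:
`X ∖ Z ⊇ CM(X)`, indeed `= CM(X)`), and the stalks of `X'` at its CLOSED points lying OVER the
support of `J` are Cohen–Macaulay (Thm 5.2 (ii): "the exceptional divisor has an open
Cohen–Macaulay neighborhood"), then every stalk of `X'` is Cohen–Macaulay — off the centre `π` is an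
isomorphism (Stacks 02OS) so the stalks are those of `X`, and the closed points suffice
(`cmClause_of_closedPoints`). [cite: Cesnavicius2021, Thm. 5.3 (proof)] -/
theorem cmClause_of_isBlowup_of_closedPoints {X' : Scheme.{u}} {π : X' ⟶ X}
    {J : X.IdealSheafData} {k : Type u} [Field k] (f : X ⟶ Spec (.of k))
    [LocallyOfFiniteType f] (hπ : IsBlowup π J)
    (hX : ∀ x : X, x ∉ (J.support : Set X) → ∀ d : ℕ, ringKrullDim (X.presheaf.stalk x) = d →
      ∀ s : Fin d → X.presheaf.stalk x, (Ideal.span (Set.range s)).radical.IsMaximal →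
        IsWeaklyRegular (X.presheaf.stalk x) (List.ofFn s))
    (hX' : ∀ x' : X', IsClosed ({x'} : Set X') → π x' ∈ (J.support : Set X) →
      ∀ d : ℕ, ringKrullDim (X'.presheaf.stalk x') = d →
        ∀ s : Fin d → X'.presheaf.stalk x', (Ideal.span (Set.range s)).radical.IsMaximal →
          IsWeaklyRegular (X'.presheaf.stalk x') (List.ofFn s)) :
    ∀ x' : X', ∀ d : ℕ, ringKrullDim (X'.presheaf.stalk x') = d →
      ∀ s : Fin d → X'.presheaf.stalk x', (Ideal.span (Set.range s)).radical.IsMaximal →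
        IsWeaklyRegular (X'.presheaf.stalk x') (List.ofFn s) := by
  haveI : IsLocallyNoetherian X := LocallyOfFiniteType.isLocallyNoetherian f
  haveI : IsProper π := hπ.isProper
  refine cmClause_of_closedPoints_of_locallyOfFiniteType (π ≫ f) fun x' hx'c => ?_
  by_cases hx' : π x' ∈ (J.support : Set X)
  · exact hX' x' hx'c hx'
  · -- off the centre the blowing up is an isomorphism, so `𝒪_{X, π x'} ≅ 𝒪_{X', x'}`
    haveI : IsIso (π ∣_ centreCompl J) := hπ.isIso_compl
    haveI := isIso_stalkMap_of_isIso_restrict π (centreCompl J) x' hx'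
    exact cmClause_transport (asIso (π.stalkMap x')).commRingCatIsoToRingEquiv (hX (π x') hx')

/-- **Kawasaki's Macaulayfication, endgame shape**: `KawasakiMacaulayfication` follows from the
existence, for every integral `X` separated and of finite type over a field, of an ideal sheaf
`J ≠ ⊥` whose support contains every non-Cohen–Macaulay point of `X`, and a blowing up of `X`
along `J` whose stalks at the closed points over the support of `J` are Cohen–Macaulay.
[cite: Cesnavicius2021, Thm. 5.3 (proof)] -/
theorem kawasakiMacaulayfication_of_exists_isBlowup_nonCMLocus
    (h : ∀ (k : Type u) [Field k] (X : Scheme.{u}) (f : X ⟶ Spec (.of k)),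
      IsSeparated f → LocallyOfFiniteType f → QuasiCompact f → IsIntegral X →
        ∃ (J : X.IdealSheafData) (X' : Scheme.{u}) (π : X' ⟶ X), J ≠ ⊥ ∧ IsBlowup π J ∧
          (∀ x : X, x ∉ (J.support : Set X) → ∀ d : ℕ, ringKrullDim (X.presheaf.stalk x) = d →
            ∀ s : Fin d → X.presheaf.stalk x, (Ideal.span (Set.range s)).radical.IsMaximal →
              IsWeaklyRegular (X.presheaf.stalk x) (List.ofFn s)) ∧
          ∀ x' : X', IsClosed ({x'} : Set X') → π x' ∈ (J.support : Set X) →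
            ∀ d : ℕ, ringKrullDim (X'.presheaf.stalk x') = d →
              ∀ s : Fin d → X'.presheaf.stalk x', (Ideal.span (Set.range s)).radical.IsMaximal →
                IsWeaklyRegular (X'.presheaf.stalk x') (List.ofFn s)) :
    KawasakiMacaulayfication.{u} := by
  refine kawasakiMacaulayfication_of_exists_isBlowup fun k _ X f hs hl hq hX => ?_
  obtain ⟨J, X', π, hJ, hπ, hoff, hover⟩ := h k X f hs hl hq hX
  haveI := hl
  exact ⟨J, X', π, hJ, hπ, cmClause_of_isBlowup_of_closedPoints f hπ hoff hover⟩

/-- **Česnavičius's Macaulayfication, endgame shape** (Thm 5.3 verbatim in the tree's vocabulary,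
minus projectivity): `CesnaviciusMacaulayfication` follows from the existence, for every integral
`X` separated and of finite type over a field, of an ideal sheaf `J ≠ ⊥` whose support is EXACTLY
the set of non-Cohen–Macaulay points of `X`, and a blowing up of `X` along `J` whose stalks at the
closed points over the support of `J` are Cohen–Macaulay. [cite: Cesnavicius2021, Thm. 5.3] -/
theorem cesnaviciusMacaulayfication_of_exists_isBlowup_nonCMLocus
    (h : ∀ (k : Type u) [Field k] (X : Scheme.{u}) (f : X ⟶ Spec (.of k)),
      IsSeparated f → LocallyOfFiniteType f → QuasiCompact f → IsIntegral X →
        ∃ (J : X.IdealSheafData) (X' : Scheme.{u}) (π : X' ⟶ X), J ≠ ⊥ ∧ IsBlowup π J ∧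
          (∀ x : X, x ∈ (J.support : Set X) ↔
            ¬ ∀ d : ℕ, ringKrullDim (X.presheaf.stalk x) = d →
              ∀ s : Fin d → X.presheaf.stalk x, (Ideal.span (Set.range s)).radical.IsMaximal →
                IsWeaklyRegular (X.presheaf.stalk x) (List.ofFn s)) ∧
          ∀ x' : X', IsClosed ({x'} : Set X') → π x' ∈ (J.support : Set X) →
            ∀ d : ℕ, ringKrullDim (X'.presheaf.stalk x') = d →
              ∀ s : Fin d → X'.presheaf.stalk x', (Ideal.span (Set.range s)).radical.IsMaximal →
                IsWeaklyRegular (X'.presheaf.stalk x') (List.ofFn s)) :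
    CesnaviciusMacaulayfication.{u} := by
  refine cesnaviciusMacaulayfication_of_exists_isBlowup fun k _ X f hs hl hq hX => ?_
  obtain ⟨J, X', π, hJ, hπ, hZ, hover⟩ := h k X f hs hl hq hX
  haveI := hl
  refine ⟨J, X', π, hJ, hπ, fun x hx => (hZ x).mp hx, ?_⟩
  exact cmClause_of_isBlowup_of_closedPoints f hπ (fun x hx => not_not.mp ((hZ x).not.mp hx)) hover

end Literature.AlgebraicGeometry.Resolution

end
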